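import Summits.HodgeConjecture.CorCM.GaloisQuaternionCyclicPrimeNondegenerate
import Summits.HodgeConjecture.CorCM.CyclotomicFieldSumOfTwoSquares
import Mathlib.FieldTheory.IntermediateField.Adjoin.Algebra
import Mathlib.RingTheory.RootsOfUnity.Complex
import HarnessLib

/-!
# `Gal(K/ℚ) ≅ Q₈ × C_p` with `ord_p(2)` odd is GOOD: the Hodge conjecture for all powers of every simple CM abelian
# `4p`-fold with complex multiplication by `K` — unconditionally (`p = 7, 23, 31, 47, 89, …`)

COR-CM (cell `pub-hodgecm2`), binder seat b04 (gen 25), count-neutral claim QUATERNION-CYCLIC-PRIME, part IV (capstone):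
part II (`CorCM/GaloisQuaternionCyclicPrimeNondegenerate`) proved nondegeneracy of every primitive CM type of a Galois CM field
with group `Q₈ × C_p` modulo the field hypothesis «`−1` is not a sum of two squares in a subfield `E ⊆ ℂ` containing `μ_p`»;
part III (`CorCM/CyclotomicFieldSumOfTwoSquares`) proved that hypothesis for `E = ℚ(ζ_p) ⊆ ℂ` whenever the multiplicative
order of `2` modulo `p` is ODD.  KERNEL ONLY: theorems; no definition, no named fact, no `sorry`.  `HC_CM` is neither used
nor claimed.

THEOREM (`isNondegenerate_of_isPrimitive_of_odd_orderOf_two`, `hodgeConjectureFor_pow_of_isSimple_of_odd_orderOf_two`).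
Let `K` be a Galois CM field with `Gal(K/ℚ) ≅ Q₈ × C_p` (`p` prime) and suppose `ord_p(2)` is odd.  Then every primitive CM
type of `K` is nondegenerate (rank `4p + 1`); every SIMPLE abelian variety `A` (of dimension `4p`) with complex multiplication
by `K` satisfies `Bᵐ(Aⁿ) ⊗ ℂ = Dᵐ(Aⁿ) ⊗ ℂ` and the HODGE CONJECTURE together with ALL ITS POWERS.  In the classification of
this lineage (gens 11–25): `Q₈ × C_p` is GOOD for `ord_p(2)` odd — `p = 7` (`ord = 3`), `23` (`11`), `31` (`5`), `47` (`23`),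
`71` (`35`), `73` (`9`), `79` (`39`), `89` (`11`), … — and BAD (kernel certificates, gens 20/24) for `p = 3, 5, 11`; the
seat's exhaustive two-sheet census also finds `Q₈ × C₁₃` BAD.  Conjecture (gen 24): GOOD ⟺ `ord_p(2)` odd.  This is the
first GOOD family of the classification whose status is decided by an ARITHMETIC invariant of `p` rather than by the shape
of the group.

* §1 `exists_subfield_of_odd_orderOf_two` — `E = ℚ(e^{2πi/p}) ⊆ ℂ` contains `μ_p` and `−1 ∉ E² + E²`.
* §2 `ne_two_of_odd_orderOf_two`, **`isNondegenerate_of_isPrimitive_of_odd_orderOf_two`**, `cmTypeRank_eq_of_isPrimitive_of_odd_orderOf_two`.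
* §3 **`hodgeConjectureFor_pow_of_isSimple_of_odd_orderOf_two`**, `hodgeConjectureFor_of_isSimple_of_odd_orderOf_two`,
  `hodgeClassSpan_pow_eq_divisorClassesSpan_of_isSimple_of_odd_orderOf_two`.
* §4 Instances: `orderOf_two_zmod_seven` (`= 3`), `…_twentyThree` (`= 11`), `…_thirtyOne` (`= 5`), `…_fortySeven` (`= 23`),
  `…_eightyNine` (`= 11`); `hodgeConjectureFor_pow_of_isSimple_quaternion_cyclicSeven` (`Q₈ × C₇`, order `56`, CM `28`-folds).

## References

* [Kubota1965] T. Kubota, Trans. AMS 118 (1965), §2, §4 Lemma 2.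
* [Dodson1984] B. Dodson, *The structure of Galois groups of CM-fields*, Trans. AMS 283 (1984), §3.1, §5.3.
* [Shimura1998] G. Shimura, *Abelian Varieties with Complex Multiplication and Modular Functions*, §8.2 Prop. 26.
* [Gordon1999HodgeAVSurvey] B. B. Gordon, *A survey of the Hodge conjecture for abelian varieties*, Thm. 6.4, §9.4.
* [FeinGordonSmith1971] B. Fein, B. Gordon, J. H. Smith, J. Number Theory 3 (1971), 310–315 (the level of `ℚ(ζ_m)`).
-/

noncomputable section

open CategoryTheory CategoryTheory.Limits NumberField
open scoped BigOperators

namespace Summit.HodgeConjecture.CorCM.GaloisQuaternionCyclic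

open Literature.NumberTheory.ComplexMultiplication
open Literature.AlgebraicGeometry.Motives (AbelianVariety CMType)
open Literature.AlgebraicGeometry.HodgeTheory
open Literature.AlgebraicGeometry.ComplexMultiplication (IsCMTypeRealisation isSimple_iff_isPrimitive)
open Literature.AlgebraicGeometry.Pohlmann1968
open Summit.HodgeConjecture.CorCM.CyclotomicSquares
open QuaternionGroup

/-! ## §1 The subfield `ℚ(ζ_p) ⊆ ℂ` -/

section Subfield

variable {p : ℕ}

/-- **`E = ℚ(e^{2πi/p}) ⊆ ℂ` contains all `p`-th roots of unity and, for `ord_p(2)` odd, `−1` is not a sum of two squares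
in `E`.** [cite: FeinGordonSmith1971, pp. 310–315] -/
theorem exists_subfield_of_odd_orderOf_two (hp : p.Prime) (hodd : Odd (orderOf (2 : ZMod p))) :
    ∃ E : Subfield ℂ, (∀ z : ℂ, z ^ p = 1 → z ∈ E) ∧ (∀ x ∈ E, ∀ y ∈ E, x ^ 2 + y ^ 2 ≠ -1) := by
  haveI : NeZero p := ⟨hp.ne_zero⟩
  have hζ := Complex.isPrimitiveRoot_exp p hp.ne_zero
  set ζ : ℂ := Complex.exp (2 * Real.pi * Complex.I / p) with hζ_def
  have halg : (IntermediateField.adjoin ℚ {ζ}).toSubalgebra = Algebra.adjoin ℚ {ζ} :=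
    IntermediateField.adjoin_simple_toSubalgebra_of_isAlgebraic (hζ.isIntegral hp.pos).tower_top.isAlgebraic
  have hmem : ∀ x : ℂ, x ∈ (IntermediateField.adjoin ℚ {ζ}).toSubfield ↔ x ∈ Algebra.adjoin ℚ {ζ} := fun x => by
    rw [IntermediateField.mem_toSubfield, ← IntermediateField.mem_toSubalgebra, halg]
  refine ⟨(IntermediateField.adjoin ℚ {ζ}).toSubfield, fun z hz => ?_, fun x hx y hy => ?_⟩
  · obtain ⟨i, -, rfl⟩ := hζ.eq_pow_of_pow_eq_one hz
    rw [hmem]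
    exact Subalgebra.pow_mem _ (Algebra.self_mem_adjoin_singleton ℚ ζ) i
  · rw [hmem] at hx hy
    exact sq_add_sq_ne_neg_one_of_mem_adjoin hp hodd hζ hx hy

/-- `ord_p(2)` odd forces `p ≠ 2` (`2 = 0` in `ℤ/2` has order `0`). [folklore] -/
theorem ne_two_of_odd_orderOf_two (hodd : Odd (orderOf (2 : ZMod p))) : p ≠ 2 := by
  rintro rfl
  have h0 : orderOf (2 : ZMod 2) = 0 := by
    rw [orderOf_eq_zero_iff']
    intro n hn
    rw [show (2 : ZMod 2) = 0 from rfl, zero_pow hn.ne']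
    exact zero_ne_one
  rw [h0] at hodd
  exact Nat.not_odd_zero hodd

end Subfield

/-! ## §2 Nondegeneracy for `ord_p(2)` odd -/

section Field

variable {p : ℕ} [Fact p.Prime]
variable {K : Type} [Field K] [NumberField K] [IsCMField K] [IsGalois ℚ K]

/-- **THEOREM.  `Gal(K/ℚ) ≅ Q₈ × C_p` with `ord_p(2)` odd: every PRIMITIVE CM type of `K` is NONDEGENERATE** — parts II + III,
unconditionally. [cite: Kubota1965, §4 Lemma 2] [cite: Shimura1998, §8.2 Prop. 26] [cite: FeinGordonSmith1971, pp. 310–315] -/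
theorem isNondegenerate_of_isPrimitive_of_odd_orderOf_two (hodd : Odd (orderOf (2 : ZMod p)))
    (e : (K ≃ₐ[ℚ] K) ≃* QuaternionGroup 2 × Multiplicative (ZMod p)) {Φ : CMType K} (φ₀ : K →+* ℂ)
    (hprim : IsPrimitive (ℂ ≃+* ℂ) Φ.1 φ₀) : IsNondegenerate Φ := by
  obtain ⟨E, hEμ, hE⟩ := exists_subfield_of_odd_orderOf_two (Fact.out : p.Prime) hodd
  exact isNondegenerate_of_isPrimitive_quaternion_cyclic (ne_two_of_odd_orderOf_two hodd) E hEμ hE e φ₀ hprim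

/-- The rank: `cmTypeRank Φ = 4p + 1`. [cite: Kubota1965, §2 (p. 115)] -/
theorem cmTypeRank_eq_of_isPrimitive_of_odd_orderOf_two (hodd : Odd (orderOf (2 : ZMod p)))
    (e : (K ≃ₐ[ℚ] K) ≃* QuaternionGroup 2 × Multiplicative (ZMod p)) {Φ : CMType K} (φ₀ : K →+* ℂ)
    (hprim : IsPrimitive (ℂ ≃+* ℂ) Φ.1 φ₀) : cmTypeRank Φ = 4 * p + 1 := by
  obtain ⟨E, hEμ, hE⟩ := exists_subfield_of_odd_orderOf_two (Fact.out : p.Prime) hodd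
  exact cmTypeRank_eq_of_isPrimitive_quaternion_cyclic (ne_two_of_odd_orderOf_two hodd) E hEμ hE e φ₀ hprim

end Field

/-! ## §3 The Hodge conjecture for the simple CM abelian varieties and their powers -/

section Geometry

variable {p : ℕ} [Fact p.Prime]
variable {K : Type} [Field K] [NumberField K] [IsCMField K] [IsGalois ℚ K]
variable {Φ : CMType K} {A : AbelianVariety ℂ} {ι : 𝓞 K →+* End A}
  {θ : K →+* Module.End ℂ (complexBetti A.X 1)}

/-- **THE HODGE CONJECTURE FOR EVERY POWER OF EVERY SIMPLE ABELIAN VARIETY WITH COMPLEX MULTIPLICATION BY A GALOIS CM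
FIELD WITH GROUP `Q₈ × C_p`, `ord_p(2)` ODD** (`p = 7, 23, 31, 47, 71, 73, 79, 89, …`; dimension `4p`) — unconditionally.
[cite: Gordon1999HodgeAVSurvey, Thm. 6.4] [cite: Shimura1998, §8.2 Prop. 26] -/
theorem hodgeConjectureFor_pow_of_isSimple_of_odd_orderOf_two (hodd : Odd (orderOf (2 : ZMod p)))
    (e : (K ≃ₐ[ℚ] K) ≃* QuaternionGroup 2 × Multiplicative (ZMod p)) (hA : IsCMTypeRealisation Φ A ι θ)
    (hs : A.IsSimple) (N : ℕ) :
    HodgeConjectureFor (⨁ fun _ : Fin N => A).dim (⨁ fun _ : Fin N => A).X := by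
  obtain ⟨E, hEμ, hE⟩ := exists_subfield_of_odd_orderOf_two (Fact.out : p.Prime) hodd
  exact hodgeConjectureFor_pow_of_isSimple_quaternion_cyclic (ne_two_of_odd_orderOf_two hodd) E hEμ hE e hA hs N

/-- The Hodge conjecture for the simple abelian variety itself. [cite: Gordon1999HodgeAVSurvey, Thm. 6.4] -/
theorem hodgeConjectureFor_of_isSimple_of_odd_orderOf_two (hodd : Odd (orderOf (2 : ZMod p)))
    (e : (K ≃ₐ[ℚ] K) ≃* QuaternionGroup 2 × Multiplicative (ZMod p)) (hA : IsCMTypeRealisation Φ A ι θ)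
    (hs : A.IsSimple) : HodgeConjectureFor A.dim A.X := by
  obtain ⟨E, hEμ, hE⟩ := exists_subfield_of_odd_orderOf_two (Fact.out : p.Prime) hodd
  exact hodgeConjectureFor_of_isSimple_quaternion_cyclic (ne_two_of_odd_orderOf_two hodd) E hEμ hE e hA hs

/-- `Bᵐ(Aⁿ) ⊗ ℂ = Dᵐ(Aⁿ) ⊗ ℂ` on every power (White–Hazama). [cite: Gordon1999HodgeAVSurvey, §9.3] -/
theorem hodgeClassSpan_pow_eq_divisorClassesSpan_of_isSimple_of_odd_orderOf_two (hodd : Odd (orderOf (2 : ZMod p)))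
    (e : (K ≃ₐ[ℚ] K) ≃* QuaternionGroup 2 × Multiplicative (ZMod p)) (hA : IsCMTypeRealisation Φ A ι θ)
    (hs : A.IsSimple) (N m : ℕ) :
    Literature.AlgebraicGeometry.VanGeemen1994.hodgeClassSpan (⨁ fun _ : Fin N => A).dim (⨁ fun _ : Fin N => A).X m =
      Literature.Barriers.HodgeConjecture.divisorClassesSpan (⨁ fun _ : Fin N => A).X
        (⨁ fun _ : Fin N => A).dim m := by
  obtain ⟨E, hEμ, hE⟩ := exists_subfield_of_odd_orderOf_two (Fact.out : p.Prime) hodd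
  exact hodgeClassSpan_pow_eq_divisorClassesSpan_of_isSimple_quaternion_cyclic (ne_two_of_odd_orderOf_two hodd)
    E hEμ hE e hA hs N m

end Geometry

/-! ## §4 Instances: `p = 7, 23, 31, 47, 89` -/

section Instances

/-- `ord₇(2) = 3`. [folklore] -/
theorem orderOf_two_zmod_seven : orderOf (2 : ZMod 7) = 3 :=
  haveI : Fact (Nat.Prime 3) := ⟨Nat.prime_three⟩
  orderOf_eq_prime (by decide) (by decide)

/-- `ord₂₃(2) = 11`. [folklore] -/
theorem orderOf_two_zmod_twentyThree : orderOf (2 : ZMod 23) = 11 :=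
  haveI : Fact (Nat.Prime 11) := ⟨by norm_num⟩
  orderOf_eq_prime (by decide) (by decide)

/-- `ord₃₁(2) = 5`. [folklore] -/
theorem orderOf_two_zmod_thirtyOne : orderOf (2 : ZMod 31) = 5 :=
  haveI : Fact (Nat.Prime 5) := ⟨Nat.prime_five⟩
  orderOf_eq_prime (by decide) (by decide)

/-- `ord₄₇(2) = 23`. [folklore] -/
theorem orderOf_two_zmod_fortySeven : orderOf (2 : ZMod 47) = 23 :=
  haveI : Fact (Nat.Prime 23) := ⟨by norm_num⟩
  orderOf_eq_prime (by decide) (by decide)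

/-- `ord₈₉(2) = 11`. [folklore] -/
theorem orderOf_two_zmod_eightyNine : orderOf (2 : ZMod 89) = 11 :=
  haveI : Fact (Nat.Prime 11) := ⟨by norm_num⟩
  orderOf_eq_prime (by decide) (by decide)

variable {K : Type} [Field K] [NumberField K] [IsCMField K] [IsGalois ℚ K]
variable {Φ : CMType K} {A : AbelianVariety ℂ} {ι : 𝓞 K →+* End A}
  {θ : K →+* Module.End ℂ (complexBetti A.X 1)}

/-- **`Q₈ × C₇` (order `56`) is GOOD**: the Hodge conjecture for every power of every simple CM abelian `28`-fold with
complex multiplication by a Galois CM field with group `Q₈ × C₇` (gen 24's exhaustive two-sheet census predicted it).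
[cite: Gordon1999HodgeAVSurvey, Thm. 6.4] -/
theorem hodgeConjectureFor_pow_of_isSimple_quaternion_cyclicSeven
    (e : (K ≃ₐ[ℚ] K) ≃* QuaternionGroup 2 × Multiplicative (ZMod 7)) (hA : IsCMTypeRealisation Φ A ι θ)
    (hs : A.IsSimple) (N : ℕ) :
    HodgeConjectureFor (⨁ fun _ : Fin N => A).dim (⨁ fun _ : Fin N => A).X :=
  haveI : Fact (Nat.Prime 7) := ⟨by norm_num⟩
  hodgeConjectureFor_pow_of_isSimple_of_odd_orderOf_two (by rw [orderOf_two_zmod_seven]; exact ⟨1, rfl⟩) e hA hs N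

/-- Every primitive CM type of a `Q₈ × C₇`-CM field is nondegenerate (rank `29`). [cite: Kubota1965, §4 Lemma 2] -/
theorem isNondegenerate_of_isPrimitive_quaternion_cyclicSeven
    (e : (K ≃ₐ[ℚ] K) ≃* QuaternionGroup 2 × Multiplicative (ZMod 7)) (Φ : CMType K) (φ₀ : K →+* ℂ)
    (hprim : IsPrimitive (ℂ ≃+* ℂ) Φ.1 φ₀) : IsNondegenerate Φ ∧ cmTypeRank Φ = 29 :=
  haveI : Fact (Nat.Prime 7) := ⟨by norm_num⟩
  have hodd : Odd (orderOf (2 : ZMod 7)) := by rw [orderOf_two_zmod_seven]; exact ⟨1, rfl⟩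
  ⟨isNondegenerate_of_isPrimitive_of_odd_orderOf_two hodd e φ₀ hprim,
    cmTypeRank_eq_of_isPrimitive_of_odd_orderOf_two hodd e φ₀ hprim⟩

/-- **`Q₈ × C₂₃`, `Q₈ × C₃₁`, `Q₈ × C₄₇`, `Q₈ × C₈₉` are GOOD** (`ord_p(2) = 11, 5, 23, 11`): the Hodge conjecture for all
powers of their simple CM abelian `92`-, `124`-, `188`-, `356`-folds. [cite: Gordon1999HodgeAVSurvey, Thm. 6.4] -/
theorem hodgeConjectureFor_pow_of_isSimple_quaternion_cyclic_examples :
    (∀ (e : (K ≃ₐ[ℚ] K) ≃* QuaternionGroup 2 × Multiplicative (ZMod 23)), IsCMTypeRealisation Φ A ι θ → A.IsSimple →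
      ∀ N : ℕ, HodgeConjectureFor (⨁ fun _ : Fin N => A).dim (⨁ fun _ : Fin N => A).X) ∧
    (∀ (e : (K ≃ₐ[ℚ] K) ≃* QuaternionGroup 2 × Multiplicative (ZMod 31)), IsCMTypeRealisation Φ A ι θ → A.IsSimple →
      ∀ N : ℕ, HodgeConjectureFor (⨁ fun _ : Fin N => A).dim (⨁ fun _ : Fin N => A).X) ∧
    (∀ (e : (K ≃ₐ[ℚ] K) ≃* QuaternionGroup 2 × Multiplicative (ZMod 47)), IsCMTypeRealisation Φ A ι θ → A.IsSimple →
      ∀ N : ℕ, HodgeConjectureFor (⨁ fun _ : Fin N => A).dim (⨁ fun _ : Fin N => A).X) ∧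
    (∀ (e : (K ≃ₐ[ℚ] K) ≃* QuaternionGroup 2 × Multiplicative (ZMod 89)), IsCMTypeRealisation Φ A ι θ → A.IsSimple →
      ∀ N : ℕ, HodgeConjectureFor (⨁ fun _ : Fin N => A).dim (⨁ fun _ : Fin N => A).X) := by
  haveI : Fact (Nat.Prime 23) := ⟨by norm_num⟩
  haveI : Fact (Nat.Prime 31) := ⟨by norm_num⟩
  haveI : Fact (Nat.Prime 47) := ⟨by norm_num⟩
  haveI : Fact (Nat.Prime 89) := ⟨by norm_num⟩
  refine ⟨fun e hA hs N => ?_, fun e hA hs N => ?_, fun e hA hs N => ?_, fun e hA hs N => ?_⟩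
  · exact hodgeConjectureFor_pow_of_isSimple_of_odd_orderOf_two
      (by rw [orderOf_two_zmod_twentyThree]; exact ⟨5, rfl⟩) e hA hs N
  · exact hodgeConjectureFor_pow_of_isSimple_of_odd_orderOf_two
      (by rw [orderOf_two_zmod_thirtyOne]; exact ⟨2, rfl⟩) e hA hs N
  · exact hodgeConjectureFor_pow_of_isSimple_of_odd_orderOf_two
      (by rw [orderOf_two_zmod_fortySeven]; exact ⟨11, rfl⟩) e hA hs N
  · exact hodgeConjectureFor_pow_of_isSimple_of_odd_orderOf_two
      (by rw [orderOf_two_zmod_eightyNine]; exact ⟨5, rfl⟩) e hA hs N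

end Instances

end Summit.HodgeConjecture.CorCM.GaloisQuaternionCyclic

end
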